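import Summits.BirchSwinnertonDyer.BirchSwinnertonDyer.Theorems.GenusKolyvaginAtTwoGenusPrimitiveSupplyAtTwoTwistingPrimeLevelFourClass
import Summits.BirchSwinnertonDyer.BirchSwinnertonDyer.Theorems.GenusKolyvaginAtTwoGenusPrimitiveSupplyAtTwoTwoAdicImageOverKH1
import Summits.BirchSwinnertonDyer.BirchSwinnertonDyer.Theorems.GenusKolyvaginAtTwoOffCutResidualAtTwoRSocleSelectionRealVisibleDescent
import Summits.BirchSwinnertonDyer.BirchSwinnertonDyer.Theorems.GenusKolyvaginAtTwoEquivariantKolyvaginExactAtTwoEigenClassesFinite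
import Summits.BirchSwinnertonDyer.BirchSwinnertonDyer.Theorems.GenusKolyvaginAtTwoVisiblePairAtTwoInjective
import Summits.BirchSwinnertonDyer.BirchSwinnertonDyer.Theorems.GenusKolyvaginAtTwoPowDvdShaCardAtTwoRTLevelRange
import Literature.NumberTheory.EllipticCurves.Rank1Residual.Typed.X5DescentSelmer
import Literature.NumberTheory.EllipticCurves.TwoTorsionOddDegreeBaseChangeProofs
import Literature.NumberTheory.EllipticCurves.ArtinFormalismQuadraticLocalProofs
import HarnessLib

/-!
# Route `GenusKolyvaginAtTwo`, residual `OffCutResidualAtTwoR` (stmt-BirchSwinnertonDyer-31767), LINE 26 «lw2_phantom_exclusion»,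
# STUB `stub_KLW` (THE LEVER): phantom exclusion at EVERY level `2^M` from ONE level-2 witness over the Heegner field

Width seat `bsd-line-gk2-p4` g31 (cell `bsd-f1-sign2`), `--supports stmt-BirchSwinnertonDyer-31767 --as helper`.  THEOREMS ONLY (no
definition, no named fact, no `sorry`).  **BSD is NOT proved by this file; nothing is closed by it alone.**

WHAT.  LINE 26 (`Cruxes/OffCutResidualAtTwoR/Lines/lw2_phantom_exclusion.lean`, pen bsd-idea-1 g24/g25, critic #471 PASS) re-sources the
ONE hypothesis of the genus engine that consumes the odd multiplicative prime — «no non-zero PHANTOM class of `H¹(K, E[2^M])` (one dying on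
`Γ_{K(E[2^M])}`) is Kummer at every place over `2N`» (`(NPh_M)`, LINE 18) — from the LEVEL-2 Lawson–Wuthrich class: its load-bearing stub
`stub_KLW` says that if every non-zero class of `H¹(K, E[2])` dying on `Γ_{K(E[4])}` fails to be Kummer at ONE place `w₀`, then `(NPh_M)`
holds for EVERY `M ≥ 1`.  This file proves `stub_KLW` VERBATIM (`nonPhantom_baseChange_of_levelTwoWitness`, last theorem), on the frame of
the route (`ρ_{E,2^n}` onto over `ℚ` for all `n`; `K` imaginary quadratic, `d_K` odd, `d_K·(−|Δ|)` and `d_K·(−2|Δ|)` non-squares — the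
binders `Odd (∏ c_p)`, Heegner, `2N ∈ w₀` of the stub are carried but idle).

THE ARGUMENT (pure Galois cohomology of the division tower + Kummer functoriality; no place of `ℚ` other than `w₀` is looked at).
* §1 `h1Eval_torsionH1ZSMul` — `[[m]_* z, ρ] = m·[z, ρ]` (cocycle level), companion of `[ι_* x, ρ] = [x, ρ]`.
* §2 `forall_torsionFixing_four_h1Eval_eq_zero_of_pow_baseChange` — **over the Heegner field, a class of `H¹(K, E[2])` dying on
  `Γ_{K(E[2^M])}` dies on `Γ_{K(E[4])}`** (`M ≥ 1`).  Proof WITHOUT redoing gk2-p4 g10's `GL₂(ℤ/2^k)`-descent over `K`: the level-`4`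
  class `ξ ∈ H¹(ℚ, E[2])` EXISTS (g10 `exists_ne_zero_forall_torsionFixing_four_h1Eval_eq_zero`), `res_K ξ ≠ 0` (`res_K` injective,
  `E(K)[2] = 0`) dies on `Γ_{K(E[4])} ⊆ Γ_{K(E[2^M])}`; the lifts `ι_{1→M} z`, `ι_{1→M} res_K ξ` are two classes of `H¹(K, E[2^M])` dying on
  `Γ_{K(E[2^M])}`, hence `0` or EQUAL (gk2-p5 `eq_zero_or_eq_zero_or_eq_of_forall_h1Eval_eq_zero_heegner` = Lawson–Wuthrich's `#H¹ ≤ 2`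
  over `K`), and `ι` is injective (`E(K)[2] = 0`): so `z ∈ {0, res_K ξ}`.
* §3 `eq_zero_of_levelTwoWitness` — with the witness at `w₀`, such a `z` Kummer at `w₀` is `0`.
* §4 `eq_zero_pow_of_levelTwoWitness` — induction on the level `2^j ≤ 2^M` inside the fixed phantom level `2^M`: `π = [2^j]_* :
  H¹(K, E[2^(j+1)]) → H¹(K, E[2])` preserves «dies on `Γ_{K(E[2^M])}`» (§1) and «Kummer at `w₀`» (`torsionH1ZSMul_mem_selmerLocalKer_of_mem`),
  so `π z = 0` (§3), i.e. `2^j · z = ι_* π z = 0`; exactness of `H¹(K,E[2^j]) → H¹(K,E[2^(j+1)]) → H¹(K,E[2])` (LEAD gk2-p1 g16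
  `RelaxedCount.exists_map_torsionInclusion_eq_of_nsmul_eq_zero`, `E(K)[2] = 0`) gives `z = ι_* z₁`, and `z₁` inherits both properties
  (`[ι_* z₁, ρ] = [z₁, ρ]`, `RelaxedCount.torsionH1OfDvd_mem_selmerLocalKer_iff_mem`) — induct.
* §5 `nonPhantom_baseChange_of_levelTwoWitness` = `stub_KLW` VERBATIM.
Print has no exact `p = 2` restriction-injectivity (`H¹(GL₂(ℤ/4), (ℤ/4)²) = ℤ/2`, Lawson–Wuthrich 2016 §7); this file does not remove the
phantom, it shows that ONE local test of its level-2 shadow decides `(NPh_M)` at all levels.  BSD is NOT proved by any of this.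

References: [LawsonWuthrich2016] §3 (Lemma 6, Thm. 1), §7.1, §8; [GrossLMS1991] §9 Prop. 9.1; [McCallumLMS1991] §4 (5), Lemma 4.6;
[SerreGaloisCohomology1997] I.§2.4, I.§2.6 (b); [GreenbergLNM1716] §2 p. 63.
-/

set_option autoImplicit false
-- the Theorems namespace of this sub repeats the summit name by design (D-0017 nested layout)
set_option linter.dupNamespace false

noncomputable section

open scoped Classical NumberField

namespace Summit.BirchSwinnertonDyer.BirchSwinnertonDyer.Theorems.GenusExact.Lw2PhantomExclusion

open WeierstrassCurve NumberField Field IsDedekindDomain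
open Literature.NumberTheory.EllipticCurves Literature.NumberTheory.GaloisRepresentations
open Summit.BirchSwinnertonDyer.BirchSwinnertonDyer.Theorems.GenusExact.SelmerDescent (h1Eval_resTorsion_eq)
open Summit.BirchSwinnertonDyer.BirchSwinnertonDyer.Theorems.GenusExact.PlusDescent.SocleSelection.RealVisible
  (mem_torsionFixing_baseChange_iff)
open Summit.BirchSwinnertonDyer.BirchSwinnertonDyer.Theorems.KolyvaginLowerBoundAtTwo (torsionFixing_le_of_dvd)

universe u

/-! ## §1 Cocycle-level functoriality of the pairing `[x, ρ]` in the coefficients -/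

section Cocycle

variable {k' : Type u} [Field k'] (V : WeierstrassCurve k')

/-- `[ι_* x, ρ] = [x, ρ]` in `E[d] ⊆ E[n]` for `ρ ∈ Γ_{K(E[n])}` (functoriality of `H¹` on cocycles; the statement and 4-line proof of
`KolyvaginAtTwo.RegularValueEngine.h1Eval_torsionH1OfDvd`, copied to keep this file's imports inside the route). [cite: SerreGaloisCohomology1997, I.§2.4] -/
private theorem h1Eval_torsionH1OfDvd' {d n : ℤ} (h : d ∣ n)
    (x : galH1Torsion V d) {ρ : absoluteGaloisGroup k'} (hρ : ρ ∈ torsionFixing V n) :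
    h1Eval V n (torsionH1OfDvd V h x) ρ = AddSubgroup.inclusion (V.geomTorsion_le_of_dvd h) (h1Eval V d x ρ) := by
  have hρd : ρ ∈ torsionFixing V d := torsionFixing_le_of_dvd V h hρ
  obtain ⟨φ, rfl⟩ := oneCocycleClass_surjective _ x
  rw [torsionH1OfDvd, resH1Hom_id_oneCocycleClass, h1Eval_oneCocycleClass V n _ hρ, h1Eval_oneCocycleClass V d _ hρd,
    contOneCocycles.push_apply]

/-- **`[[m]_* z, ρ] = m · [z, ρ]`** for `z ∈ H¹(K, E[n])`, `d ∣ n ∣ d·m`, `ρ ∈ Γ_{K(E[n])}`: the change-of-coefficients map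
`[m]_* : H¹(K, E[n]) → H¹(K, E[d])` (`torsionH1ZSMul`) is computed on cocycles value by value. [cite: SerreGaloisCohomology1997, I.§2.4]
[cite: McCallumLMS1991, §4 Lemma 4.6] -/
theorem h1Eval_torsionH1ZSMul {d n : ℤ} (h : d ∣ n) (m : ℤ) (hm : n ∣ d * m)
    (z : galH1Torsion V n) {ρ : absoluteGaloisGroup k'} (hρ : ρ ∈ torsionFixing V n) :
    h1Eval V d (torsionH1ZSMul V m hm z) ρ = geomTorsionZSMul V m hm (h1Eval V n z ρ) := by
  have hρd : ρ ∈ torsionFixing V d := torsionFixing_le_of_dvd V h hρ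
  obtain ⟨φ, rfl⟩ := oneCocycleClass_surjective _ z
  rw [torsionH1ZSMul, resH1Hom_id_oneCocycleClass, h1Eval_oneCocycleClass V d _ hρd, h1Eval_oneCocycleClass V n _ hρ,
    contOneCocycles.push_apply]

/-- `[[m]_* z, ρ] = 0` as soon as `[z, ρ] = 0` (`ρ ∈ Γ_{K(E[n])}`). [cite: SerreGaloisCohomology1997, I.§2.4] -/
theorem h1Eval_torsionH1ZSMul_eq_zero {d n : ℤ} (h : d ∣ n) (m : ℤ) (hm : n ∣ d * m)
    (z : galH1Torsion V n) {ρ : absoluteGaloisGroup k'} (hρ : ρ ∈ torsionFixing V n) (hz : h1Eval V n z ρ = 0) :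
    h1Eval V d (torsionH1ZSMul V m hm z) ρ = 0 := by
  rw [h1Eval_torsionH1ZSMul V h m hm z hρ, hz, map_zero]

/-- `[ι_* x, ρ] = 0 ↔ [x, ρ] = 0` (`ρ ∈ Γ_{K(E[n])}`; the inclusion `E[d] ↪ E[n]` is injective). [cite: SerreGaloisCohomology1997, I.§2.4] -/
theorem h1Eval_torsionH1OfDvd_eq_zero_iff {d n : ℤ} (h : d ∣ n)
    (x : galH1Torsion V d) {ρ : absoluteGaloisGroup k'} (hρ : ρ ∈ torsionFixing V n) :
    h1Eval V n (torsionH1OfDvd V h x) ρ = 0 ↔ h1Eval V d x ρ = 0 := by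
  rw [h1Eval_torsionH1OfDvd' V h x hρ, ← (AddSubgroup.inclusion (V.geomTorsion_le_of_dvd h)).map_zero,
    (AddSubgroup.inclusion_injective _).eq_iff]

/-- `ι_* ([m]_* z) = m · z` for `z ∈ H¹(K, E[n])`, `d ∣ n ∣ d·m` (the composite `E[n] →(m·) E[d] ↪ E[n]` is multiplication by `m`; computed on a
cocycle value by value — the statement and proof of `KolyvaginPairSupplyTwo.torsionH1OfDvd_torsionH1ZSMul`, copied to keep this file's imports
inside the route). [cite: McCallumLMS1991, §4 Lemma 4.6] [cite: SerreGaloisCohomology1997, I.§2.4] -/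
private theorem torsionH1OfDvd_torsionH1ZSMul' {d n : ℤ} (h : d ∣ n) (m : ℤ) (hm : n ∣ d * m) (z : galH1Torsion V n) :
    torsionH1OfDvd V h (torsionH1ZSMul V m hm z) = m • z := by
  obtain ⟨φ, rfl⟩ := oneCocycleClass_surjective _ z
  unfold torsionH1OfDvd torsionH1ZSMul
  rw [resH1Hom_id_oneCocycleClass, resH1Hom_id_oneCocycleClass]
  have key : contOneCocycles.push (AddSubgroup.inclusion (geomTorsion_le_of_dvd V h)) (fun _ _ ↦ rfl)
      (contOneCocycles.push (geomTorsionZSMul V m hm) (fun σ P ↦ geomTorsionZSMul_smul V m hm σ P) φ) =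
      m • φ := by
    apply Subtype.ext
    ext σ : 1
    rfl
  rw [key, ← oneCocycleClassₗ_apply, ← oneCocycleClassₗ_apply, map_zsmul]

/-- `[m]_*` preserves the Kummer (Selmer) local condition at a `K`-field `F`: both conditions are the vanishing of the image in `H¹(F, E)`
(`selmerLocalKer_eq_comap`), and `(E[d] ↪ E)_* ∘ [m]_* = m · (E[n] ↪ E)_*` (`torsionH1ToH1_torsionH1ZSMul`) — the statement of
`KolyvaginPairSupplyTwo.torsionH1ZSMul_mem_selmerLocalKer_of_mem`, re-proved here to keep the imports inside the route.
[cite: McCallumLMS1991, §4 Lemma 4.3 and Lemma 4.6] [cite: SilvermanAEC2009, X.§4] -/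
private theorem torsionH1ZSMul_mem_selmerLocalKer_of_mem' {K₀ : Type} [Field K₀] (X : WeierstrassCurve K₀)
    (F : Type) [Field F] [Algebra K₀ F] {d n : ℤ} (m : ℤ) (hm : n ∣ d * m) {z : galH1Torsion X n}
    (hz : z ∈ selmerLocalKer X F n) : torsionH1ZSMul X m hm z ∈ selmerLocalKer X F d := by
  rw [selmerLocalKer_eq_comap, AddSubgroup.mem_comap] at hz ⊢
  rw [torsionH1ToH1_torsionH1ZSMul]
  exact AddSubgroup.zsmul_mem _ hz m

end Cocycle

/-! ## §2 Over the Heegner field, a class of `H¹(K, E[2])` dying on `Γ_{K(E[2^M])}` dies on `Γ_{K(E[4])}` -/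

section Frame

variable (W : WeierstrassCurve ℚ) [W.IsElliptic] {K : Type} [Field K] [NumberField K]

/-- `E(K)[2] = 0` on the frame (`ρ̄_{E,2}` onto, `K` imaginary quadratic), in the `∀ P, 2P = 0 → P = 0` form.
[cite: DokchitserDokchitserMathZ2012, Theorem (1)] -/
theorem forall_two_zsmul_eq_zero_baseChange (hρ : ∀ n : ℕ, 0 < n → W.HasSurjectiveModNGaloisRep ((2 : ℤ) ^ n))
    (hK : IsImaginaryQuadratic K) :
    ∀ P : (W.baseChange K).toAffine.Point, (2 : ℤ) • P = 0 → P = 0 := by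
  have hρ2 : W.HasSurjectiveModNGaloisRep 2 := by simpa using hρ 1 one_pos
  have hbot := torsionBy_two_baseChange_eq_bot_of_hasSurjectiveModNGaloisRep_two_of_isImaginaryQuadratic W hρ2 K hK
  intro P hP
  have hmem : P ∈ AddSubgroup.torsionBy (W.baseChange K).toAffine.Point (2 : ℤ) := by
    rw [AddSubgroup.torsionBy, Submodule.mem_toAddSubgroup, Submodule.mem_torsionBy_iff]; exact hP
  rw [hbot] at hmem
  exact AddSubgroup.mem_bot.mp hmem

/-- `E(K)[2] = ⊥` on the frame, `ℕ`-cast spelling `((2 : ℕ) : ℤ)` (the hypothesis of the level-map injectivity / exactness lemmas).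
[cite: DokchitserDokchitserMathZ2012, Theorem (1)] -/
theorem torsionBy_two_baseChange_eq_bot_natCast (hρ : ∀ n : ℕ, 0 < n → W.HasSurjectiveModNGaloisRep ((2 : ℤ) ^ n))
    (hK : IsImaginaryQuadratic K) :
    AddSubgroup.torsionBy (W.baseChange K).toAffine.Point ((2 : ℕ) : ℤ) = ⊥ := by
  have hρ2 : W.HasSurjectiveModNGaloisRep 2 := by simpa using hρ 1 one_pos
  have h := torsionBy_two_baseChange_eq_bot_of_hasSurjectiveModNGaloisRep_two_of_isImaginaryQuadratic W hρ2 K hK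
  simpa using h

/-- **Restriction of a level-`4` class to the Heegner field**: for `x ∈ H¹(ℚ, E[2])` NON-ZERO and dying on `Γ_{ℚ(E[4])}` (g10's class,
`GenusKolyTwistingPrime.exists_ne_zero_forall_torsionFixing_four_h1Eval_eq_zero`), `res_K x` is non-zero (`res_K` injective as `E(K)[2] = 0`)
and dies on `Γ_{K(E_K[4])}` (`res Γ_{K(E_K[4])} ⊆ Γ_{ℚ(E[4])}`). [cite: LawsonWuthrich2016, §3 (Lemma 6, Thm. 1)] [cite: SerreGaloisCohomology1997, I.§2.6 (b)] -/
theorem resTorsion_ne_zero_and_forall_torsionFixing_four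
    (hρ : ∀ n : ℕ, 0 < n → W.HasSurjectiveModNGaloisRep ((2 : ℤ) ^ n)) (hK : IsImaginaryQuadratic K)
    {x : galH1Torsion W (2 : ℤ)} (hx0 : x ≠ 0) (hx : ∀ h ∈ torsionFixing W (4 : ℤ), h1Eval W (2 : ℤ) x h = 0) :
    resTorsion W K (2 : ℤ) x ≠ 0 ∧
      ∀ τ ∈ torsionFixing (W.baseChange K) (4 : ℤ), h1Eval (W.baseChange K) (2 : ℤ) (resTorsion W K (2 : ℤ) x) τ = 0 := by
  haveI : Algebra.IsAlgebraic ℚ K := Algebra.IsAlgebraic.of_finite ℚ K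
  have h2 : Module.finrank ℚ K = 2 := hK.1
  obtain ⟨θ, hθ, hc⟩ := exists_sq_eq_discr_not_mem_range K h2
  have hinj := GenusExact.EigenClassesFinite.resTorsion_injective_of_noTorsion W K h2 hθ hc (2 : ℤ)
    (forall_two_zsmul_eq_zero_baseChange W hρ hK)
  have h42 : torsionFixing (W.baseChange K) (4 : ℤ) ≤ torsionFixing (W.baseChange K) (2 : ℤ) :=
    torsionFixing_le_of_dvd (W.baseChange K) (by norm_num)
  refine ⟨fun h ↦ hx0 (hinj (by rw [h, map_zero])), fun τ hτ ↦ ?_⟩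
  rw [h1Eval_resTorsion_eq W K (2 : ℤ) x (h42 hτ), hx _ ((mem_torsionFixing_baseChange_iff W K (4 : ℤ) τ).mp hτ), map_zero]

/-- **The restriction of the level-`4` class to the Heegner field EXISTS**: on the frame there is a NON-ZERO `a ∈ H¹(K, E[2])` dying on
`Γ_{K(E[4])}` — `a = res_K ξ` for g10's level-`4` class `ξ`. [cite: LawsonWuthrich2016, §3 (Lemma 6, Thm. 1)] [cite: SerreGaloisCohomology1997, I.§2.6 (b)] -/
theorem exists_ne_zero_forall_torsionFixing_four_h1Eval_eq_zero_baseChange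
    (hρ : ∀ n : ℕ, 0 < n → W.HasSurjectiveModNGaloisRep ((2 : ℤ) ^ n)) (hK : IsImaginaryQuadratic K) :
    ∃ a : galH1Torsion (W.baseChange K) (2 : ℤ), a ≠ 0 ∧
      ∀ τ ∈ torsionFixing (W.baseChange K) (4 : ℤ), h1Eval (W.baseChange K) (2 : ℤ) a τ = 0 := by
  have hsurj4 : W.HasSurjectiveModNGaloisRep 4 := by have h := hρ 2 two_pos; norm_num at h; exact h
  obtain ⟨ξ, hξ0, hξ⟩ := GenusKolyTwistingPrime.exists_ne_zero_forall_torsionFixing_four_h1Eval_eq_zero W hsurj4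
  exact ⟨resTorsion W K (2 : ℤ) ξ, resTorsion_ne_zero_and_forall_torsionFixing_four W hρ hK hξ0 hξ⟩

/-- ★ **RIGIDITY OVER THE HEEGNER FIELD: a class of `H¹(K, E[2])` dying on `Γ_{K(E[2^M])}` (`M ≥ 2`) is `0` or `res_K x`**, for ANY
non-zero `x ∈ H¹(ℚ, E[2])` dying on `Γ_{ℚ(E[4])}` (frame: `ρ_{E,2^n}` onto over `ℚ` for all `n`, `K` imaginary quadratic, `d_K` odd,
`d_K·(−|Δ|)`, `d_K·(−2|Δ|)` non-squares).  Proof WITHOUT redoing g10's `GL₂(ℤ/2^k)`-descent over `K`: lift `z` and `res_K x ≠ 0` to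
`H¹(K, E[2^M])` by `ι` (injective, `E(K)[2] = 0`); both lifts die on `Γ_{K(E[2^M])}`, so they are `0` or EQUAL (Lawson–Wuthrich's
`#H¹(Gal(K(E[2^M])/K), E[2^M]) ≤ 2` over `K`, gk2-p5 `GenusKolyTwoAdicK.eq_zero_or_eq_zero_or_eq_of_forall_h1Eval_eq_zero_heegner`).  In
particular `H¹(Gal(K(E[2^M])/K), E[2]) = {0, res_K ξ} ≅ ℤ/2` for every `M ≥ 2` — LINE 26's «P2 lemma» over `K`, in the tree's currency.
[cite: LawsonWuthrich2016, §3 (Lemma 6, Thm. 1) and §7.1] [cite: GrossLMS1991, §9 Prop. 9.1] -/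
theorem eq_zero_or_eq_resTorsion_of_forall_torsionFixing_pow
    (hρ : ∀ n : ℕ, 0 < n → W.HasSurjectiveModNGaloisRep ((2 : ℤ) ^ n)) (hK : IsImaginaryQuadratic K)
    (hodd : Odd (NumberField.discr K)) (hnsq₁ : ¬ IsSquare ((NumberField.discr K : ℚ) * -|W.Δ|))
    (hnsq₂ : ¬ IsSquare ((NumberField.discr K : ℚ) * (-(2 * |W.Δ|))))
    {x : galH1Torsion W (2 : ℤ)} (hx0 : x ≠ 0) (hx : ∀ h ∈ torsionFixing W (4 : ℤ), h1Eval W (2 : ℤ) x h = 0)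
    {M : ℕ} (hM : 2 ≤ M) {z : galH1Torsion (W.baseChange K) (2 : ℤ)}
    (hz : ∀ ρ ∈ torsionFixing (W.baseChange K) ((2 ^ M : ℕ) : ℤ), h1Eval (W.baseChange K) (2 : ℤ) z ρ = 0) :
    z = 0 ∨ z = resTorsion W K (2 : ℤ) x := by
  haveI : (W.baseChange K).IsElliptic := inferInstanceAs (W.map (algebraMap ℚ K)).IsElliptic
  obtain ⟨j, rfl⟩ : ∃ j, M = j + 1 := ⟨M - 1, by omega⟩
  have h1M : (2 : ℤ) ∣ ((2 ^ (j + 1) : ℕ) : ℤ) := ⟨((2 ^ j : ℕ) : ℤ), by push_cast; ring⟩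
  have h4M : (4 : ℤ) ∣ ((2 ^ (j + 1) : ℕ) : ℤ) := by
    obtain ⟨i, rfl⟩ : ∃ i, j = i + 1 := ⟨j - 1, by omega⟩
    exact ⟨((2 ^ i : ℕ) : ℤ), by push_cast; ring⟩
  have hM4 : torsionFixing (W.baseChange K) ((2 ^ (j + 1) : ℕ) : ℤ) ≤ torsionFixing (W.baseChange K) (4 : ℤ) :=
    torsionFixing_le_of_dvd (W.baseChange K) h4M
  obtain ⟨ha0, ha⟩ := resTorsion_ne_zero_and_forall_torsionFixing_four W hρ hK hx0 hx
  -- the lifts to level `2^M`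
  have hinj : Function.Injective (torsionH1OfDvd (W.baseChange K) h1M) :=
    VisiblePairAtTwo.torsionH1OfDvd_pow_injective (W.baseChange K) (p := 2) (a := 1) (j := j + 1)
      (torsionBy_two_baseChange_eq_bot_natCast W hρ hK) _
  have hιz : ∀ ρ ∈ torsionFixing (W.baseChange K) ((2 ^ (j + 1) : ℕ) : ℤ),
      h1Eval (W.baseChange K) _ (torsionH1OfDvd (W.baseChange K) h1M z) ρ = 0 :=
    fun ρ hρ' ↦ (h1Eval_torsionH1OfDvd_eq_zero_iff (W.baseChange K) h1M z hρ').mpr (hz ρ hρ')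
  have hιa : ∀ ρ ∈ torsionFixing (W.baseChange K) ((2 ^ (j + 1) : ℕ) : ℤ),
      h1Eval (W.baseChange K) _ (torsionH1OfDvd (W.baseChange K) h1M (resTorsion W K (2 : ℤ) x)) ρ = 0 :=
    fun ρ hρ' ↦ (h1Eval_torsionH1OfDvd_eq_zero_iff (W.baseChange K) h1M _ hρ').mpr (ha ρ (hM4 hρ'))
  rcases GenusKolyTwoAdicK.eq_zero_or_eq_zero_or_eq_of_forall_h1Eval_eq_zero_heegner W hK hodd hnsq₁ hnsq₂ hρ j hιz hιa
    with h0 | h0 | heq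
  · exact Or.inl (hinj (by rw [h0, map_zero]))
  · exact absurd (hinj (by rw [h0, map_zero])) ha0
  · exact Or.inr (hinj heq)

/-- ★ **OVER THE HEEGNER FIELD, A CLASS OF `H¹(K, E[2])` DYING ON `Γ_{K(E[2^M])}` DIES ON `Γ_{K(E[4])}`** (`M ≥ 1`; same frame).
`M = 1`: `Γ_{K(E[4])} ⊆ Γ_{K(E[2])}`.  `M ≥ 2`: `z ∈ {0, res_K ξ}` by the rigidity above with g10's level-`4` class `ξ`.  The `K`-side form of
g10's «entanglement is a level-`4` phenomenon» (`GenusKolyTwistingPrime.forall_torsionFixing_four_h1Eval_eq_zero_of_forall_torsionFixing_pow`).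
[cite: LawsonWuthrich2016, §3 (Lemma 6, Thm. 1) and §7.1] [cite: GrossLMS1991, §9 Prop. 9.1] -/
theorem forall_torsionFixing_four_h1Eval_eq_zero_of_pow_baseChange
    (hρ : ∀ n : ℕ, 0 < n → W.HasSurjectiveModNGaloisRep ((2 : ℤ) ^ n)) (hK : IsImaginaryQuadratic K)
    (hodd : Odd (NumberField.discr K)) (hnsq₁ : ¬ IsSquare ((NumberField.discr K : ℚ) * -|W.Δ|))
    (hnsq₂ : ¬ IsSquare ((NumberField.discr K : ℚ) * (-(2 * |W.Δ|)))) {M : ℕ} (hM : 1 ≤ M)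
    {z : galH1Torsion (W.baseChange K) (2 : ℤ)}
    (hz : ∀ ρ ∈ torsionFixing (W.baseChange K) ((2 ^ M : ℕ) : ℤ), h1Eval (W.baseChange K) (2 : ℤ) z ρ = 0) :
    ∀ ρ ∈ torsionFixing (W.baseChange K) (4 : ℤ), h1Eval (W.baseChange K) (2 : ℤ) z ρ = 0 := by
  rcases Nat.lt_or_ge M 2 with h1 | h2M
  · -- `M = 1`: `Γ_{K(E[4])} ⊆ Γ_{K(E[2])}`
    obtain rfl : M = 1 := by omega
    intro ρ hρ4
    exact hz ρ (torsionFixing_le_of_dvd (W.baseChange K) (by norm_num) hρ4)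
  have hsurj4 : W.HasSurjectiveModNGaloisRep 4 := by have h := hρ 2 two_pos; norm_num at h; exact h
  obtain ⟨ξ, hξ0, hξ⟩ := GenusKolyTwistingPrime.exists_ne_zero_forall_torsionFixing_four_h1Eval_eq_zero W hsurj4
  have h42 : torsionFixing (W.baseChange K) (4 : ℤ) ≤ torsionFixing (W.baseChange K) (2 : ℤ) :=
    torsionFixing_le_of_dvd (W.baseChange K) (by norm_num)
  rcases eq_zero_or_eq_resTorsion_of_forall_torsionFixing_pow W hρ hK hodd hnsq₁ hnsq₂ hξ0 hξ h2M hz with rfl | rfl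
  · intro ρ hρ4
    exact h1Eval_zero (W.baseChange K) _ (h42 hρ4)
  · exact (resTorsion_ne_zero_and_forall_torsionFixing_four W hρ hK hξ0 hξ).2

/-! ## §3 The level-`2` witness kills the classes of `H¹(K, E[2])` dying on `Γ_{K(E[2^M])}` that are Kummer at `w₀` -/

/-- **At level `2`**: on the frame, if every non-zero class of `H¹(K, E[2])` dying on `Γ_{K(E[4])}` is NOT Kummer at `w₀` (the LINE 26
witness), then every class of `H¹(K, E[2])` dying on `Γ_{K(E[2^M])}` (`M ≥ 1`) that IS Kummer at `w₀` vanishes (§2). [cite: LawsonWuthrich2016, §7.1, §8] -/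
theorem eq_zero_of_levelTwoWitness
    (hρ : ∀ n : ℕ, 0 < n → W.HasSurjectiveModNGaloisRep ((2 : ℤ) ^ n)) (hK : IsImaginaryQuadratic K)
    (hodd : Odd (NumberField.discr K)) (hnsq₁ : ¬ IsSquare ((NumberField.discr K : ℚ) * -|W.Δ|))
    (hnsq₂ : ¬ IsSquare ((NumberField.discr K : ℚ) * (-(2 * |W.Δ|))))
    {w₀ : HeightOneSpectrum (𝓞 K)}
    (hwit : ∀ z : galH1Torsion (W.baseChange K) 2, z ≠ 0 →
      (∀ ρ ∈ torsionFixing (W.baseChange K) 4, h1Eval (W.baseChange K) 2 z ρ = 0) →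
        z ∉ selmerLocalKer (W.baseChange K) (w₀.adicCompletion K) 2)
    {M : ℕ} (hM : 1 ≤ M) {z : galH1Torsion (W.baseChange K) (2 : ℤ)}
    (hz : ∀ ρ ∈ torsionFixing (W.baseChange K) ((2 ^ M : ℕ) : ℤ), h1Eval (W.baseChange K) (2 : ℤ) z ρ = 0)
    (hw : z ∈ selmerLocalKer (W.baseChange K) (w₀.adicCompletion K) (2 : ℤ)) : z = 0 := by
  by_contra hne
  exact hwit z hne (forall_torsionFixing_four_h1Eval_eq_zero_of_pow_baseChange W hρ hK hodd hnsq₁ hnsq₂ hM hz) hw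

/-! ## §4 Every level: induction on `2^j ≤ 2^M` inside the phantom level `2^M` -/

/-- ★ **EVERY LEVEL.**  On the frame with the level-`2` witness at `w₀`: for `1 ≤ j ≤ M`, a class `z ∈ H¹(K, E[2^j])` dying on
`Γ_{K(E[2^M])}` and Kummer at `w₀` is `0`.  Induction on `j`: `π = [2^j]_* : H¹(K, E[2^(j+1)]) → H¹(K, E[2])` keeps both properties
(§1, `torsionH1ZSMul_mem_selmerLocalKer_of_mem`), so `π z = 0` (§3), `2^j · z = ι_* π z = 0`, `z = ι_* z₁` by exactness at `E(K)[2] = 0`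
(`RelaxedCount.exists_map_torsionInclusion_eq_of_nsmul_eq_zero`), and `z₁ ∈ H¹(K, E[2^j])` inherits both properties.
[cite: LawsonWuthrich2016, §7.1, §8] [cite: GreenbergLNM1716, §2 p. 63] [cite: McCallumLMS1991, §4 (5), Lemma 4.6] -/
theorem eq_zero_pow_of_levelTwoWitness
    (hρ : ∀ n : ℕ, 0 < n → W.HasSurjectiveModNGaloisRep ((2 : ℤ) ^ n)) (hK : IsImaginaryQuadratic K)
    (hodd : Odd (NumberField.discr K)) (hnsq₁ : ¬ IsSquare ((NumberField.discr K : ℚ) * -|W.Δ|))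
    (hnsq₂ : ¬ IsSquare ((NumberField.discr K : ℚ) * (-(2 * |W.Δ|))))
    {w₀ : HeightOneSpectrum (𝓞 K)}
    (hwit : ∀ z : galH1Torsion (W.baseChange K) 2, z ≠ 0 →
      (∀ ρ ∈ torsionFixing (W.baseChange K) 4, h1Eval (W.baseChange K) 2 z ρ = 0) →
        z ∉ selmerLocalKer (W.baseChange K) (w₀.adicCompletion K) 2)
    {M : ℕ} {j : ℕ} (hj : 1 ≤ j) (hjM : j ≤ M) (z : galH1Torsion (W.baseChange K) ((2 ^ j : ℕ) : ℤ))
    (hz : ∀ ρ ∈ torsionFixing (W.baseChange K) ((2 ^ M : ℕ) : ℤ), h1Eval (W.baseChange K) ((2 ^ j : ℕ) : ℤ) z ρ = 0)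
    (hw : z ∈ selmerLocalKer (W.baseChange K) (w₀.adicCompletion K) ((2 ^ j : ℕ) : ℤ)) : z = 0 := by
  haveI : (W.baseChange K).IsElliptic := inferInstanceAs (W.map (algebraMap ℚ K)).IsElliptic
  have hbot := torsionBy_two_baseChange_eq_bot_natCast W hρ hK
  -- induction on `j ≥ 1`, for all `z` and all `M ≥ j`
  induction j, hj using Nat.le_induction generalizing M with
  | base =>
    have hM : 1 ≤ M := hjM
    exact eq_zero_of_levelTwoWitness W hρ hK hodd hnsq₁ hnsq₂ hwit hM (z := z) hz hw
  | succ j hj ih =>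
    have hM : 1 ≤ M := by omega
    -- level bookkeeping
    have h1j1 : (2 : ℤ) ∣ ((2 ^ (j + 1) : ℕ) : ℤ) := ⟨((2 ^ j : ℕ) : ℤ), by push_cast; ring⟩
    have hjj1 : ((2 ^ j : ℕ) : ℤ) ∣ ((2 ^ (j + 1) : ℕ) : ℤ) := ⟨2, by push_cast; ring⟩
    have hj1M : ((2 ^ (j + 1) : ℕ) : ℤ) ∣ ((2 ^ M : ℕ) : ℤ) := by exact_mod_cast Nat.pow_dvd_pow 2 hjM
    have hm : ((2 ^ (j + 1) : ℕ) : ℤ) ∣ (2 : ℤ) * ((2 ^ j : ℕ) : ℤ) := ⟨1, by push_cast; ring⟩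
    have hTM : torsionFixing (W.baseChange K) ((2 ^ M : ℕ) : ℤ) ≤ torsionFixing (W.baseChange K) ((2 ^ (j + 1) : ℕ) : ℤ) := torsionFixing_le_of_dvd (W.baseChange K) hj1M
    -- `π z ∈ H¹(K, E[2])` dies on `Γ_{K(E[2^M])}` and is Kummer at `w₀`, hence `0`
    set πz : galH1Torsion (W.baseChange K) (2 : ℤ) := torsionH1ZSMul (W.baseChange K) ((2 ^ j : ℕ) : ℤ) hm z with hπz
    have hπph : ∀ ρ ∈ torsionFixing (W.baseChange K) ((2 ^ M : ℕ) : ℤ), h1Eval (W.baseChange K) (2 : ℤ) πz ρ = 0 := fun ρ hρ' ↦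
      h1Eval_torsionH1ZSMul_eq_zero (W.baseChange K) h1j1 _ hm z (hTM hρ') (hz ρ hρ')
    have hπw : πz ∈ selmerLocalKer (W.baseChange K) (w₀.adicCompletion K) (2 : ℤ) :=
      torsionH1ZSMul_mem_selmerLocalKer_of_mem' (W.baseChange K) (w₀.adicCompletion K) _ hm hw
    have hπ0 : πz = 0 := eq_zero_of_levelTwoWitness W hρ hK hodd hnsq₁ hnsq₂ hwit hM hπph hπw
    -- `2^j · z = ι_* (π z) = 0`
    have h2jz : 2 ^ j • z = 0 := by
      have h := torsionH1OfDvd_torsionH1ZSMul' (W.baseChange K) h1j1 ((2 ^ j : ℕ) : ℤ) hm z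
      rw [← hπz, hπ0, map_zero] at h
      rw [← natCast_zsmul]
      exact h.symm
    -- exactness: `z = ι_* z₁`
    obtain ⟨z₁, hz₁⟩ := RelaxedCount.exists_map_torsionInclusion_eq_of_nsmul_eq_zero (W.baseChange K) 2 hbot j 1 hjj1 z h2jz
    rw [map_torsionInclusion_one_apply] at hz₁
    -- `z₁` inherits both properties
    have hTj1 : torsionFixing (W.baseChange K) ((2 ^ M : ℕ) : ℤ) ≤ torsionFixing (W.baseChange K) ((2 ^ (j + 1) : ℕ) : ℤ) := hTM
    have hz₁ph : ∀ ρ ∈ torsionFixing (W.baseChange K) ((2 ^ M : ℕ) : ℤ), h1Eval (W.baseChange K) ((2 ^ j : ℕ) : ℤ) z₁ ρ = 0 := fun ρ hρ' ↦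
      (h1Eval_torsionH1OfDvd_eq_zero_iff (W.baseChange K) hjj1 z₁ (hTj1 hρ')).mp (by rw [hz₁]; exact hz ρ hρ')
    have hz₁w : z₁ ∈ selmerLocalKer (W.baseChange K) (w₀.adicCompletion K) ((2 ^ j : ℕ) : ℤ) :=
      (RelaxedCount.torsionH1OfDvd_mem_selmerLocalKer_iff_mem (W.baseChange K) hjj1 (w₀.adicCompletion K) z₁).mp (by rw [hz₁]; exact hw)
    have hz₁0 : z₁ = 0 := ih (by omega) z₁ hz₁ph hz₁w
    rw [← hz₁, hz₁0]
    exact map_zero _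

/-! ## §5 LINE 26 STUB `stub_KLW` VERBATIM -/

/-- ★★ **LINE 26 STUB `stub_KLW` (THE LEVER), VERBATIM: phantom exclusion from a level-`2` witness, every level.**  On the route's frame
(`E/ℚ` globally minimal, `Odd (∏ c_p)`, `ρ_{E,2^n}` onto for all `n ≥ 1`; `K` imaginary quadratic, `d_K` odd, Heegner for `N`, `d_K·(−|Δ|)` and
`d_K·(−2|Δ|)` non-squares) with a place `w₀ ∣ 2N` of `K` at which NO non-zero class of `H¹(K, E[2])` dying on `Γ_{K(E[4])}` is Kummer: for every
`M ≥ 1`, every class of `H¹(K, E[2^M])` dying on `Γ_{K(E[2^M])}` and Kummer at all places over `2N` is `0` — `(NPh_M)` of LINE 18, the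
displayed hypothesis of `stub_Q3flat` / `stub_Q4flat`, re-sourced from the level-`2` Lawson–Wuthrich class (§4 at `j = M`, Kummer at `w₀` only).
Print has no exact `p = 2` restriction-injectivity (`H¹(GL₂(ℤ/4), (ℤ/4)²) = ℤ/2`); the binders `Odd (∏ c_p)`, Heegner and `2N ∈ w₀` are carried,
not used.  BSD is NOT proved by this; `OffCutResidualAtTwoR` is NOT closed by it. [cite: LawsonWuthrich2016, §4, §7.1 and §8]
[cite: GrossLMS1991, §9 Prop. 9.1] [cite: McCallumLMS1991, §4 Lemma 4.6] -/
theorem nonPhantom_baseChange_of_levelTwoWitness :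
    ∀ (W : WeierstrassCurve ℚ) [W.IsElliptic] [W.IsGloballyMinimal] [NeZero (W.conductorNorm ℤ)],
      Odd W.tamagawaProduct → (∀ n : ℕ, 0 < n → W.HasSurjectiveModNGaloisRep ((2 : ℤ) ^ n)) →
      ∀ (K : Type) [Field K] [NumberField K], IsImaginaryQuadratic K → Odd (NumberField.discr K) →
        SatisfiesHeegnerHypothesis (W.conductorNorm ℤ) K →
        ¬ IsSquare ((NumberField.discr K : ℚ) * -|W.Δ|) → ¬ IsSquare ((NumberField.discr K : ℚ) * (-(2 * |W.Δ|))) →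
        ∀ w₀ : HeightOneSpectrum (𝓞 K), ((2 * W.conductorNorm ℤ : ℕ) : 𝓞 K) ∈ w₀.asIdeal →
          (∀ z : galH1Torsion (W.baseChange K) 2, z ≠ 0 → (∀ ρ ∈ torsionFixing (W.baseChange K) 4, h1Eval (W.baseChange K) 2 z ρ = 0) →
            z ∉ selmerLocalKer (W.baseChange K) (w₀.adicCompletion K) 2) →
        (∀ (Mlev : ℕ), 1 ≤ Mlev → ∀ z : galH1Torsion (W.baseChange K) ((2 ^ Mlev : ℕ) : ℤ),
          (∀ ρ ∈ torsionFixing (W.baseChange K) ((2 ^ Mlev : ℕ) : ℤ), h1Eval (W.baseChange K) ((2 ^ Mlev : ℕ) : ℤ) z ρ = 0) →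
          (∀ w : HeightOneSpectrum (𝓞 K), ((2 * W.conductorNorm ℤ : ℕ) : 𝓞 K) ∈ w.asIdeal →
            z ∈ selmerLocalKer (W.baseChange K) (w.adicCompletion K) ((2 ^ Mlev : ℕ) : ℤ)) → z = 0) := by
  intro W _ _ _ _hT hρ K _ _ hK hodd _hH hnsq₁ hnsq₂ w₀ hw₀ hwit Mlev hM z hz hw
  exact eq_zero_pow_of_levelTwoWitness W hρ hK hodd hnsq₁ hnsq₂ hwit hM le_rfl z hz (hw w₀ hw₀)

end Frame

end Summit.BirchSwinnertonDyer.BirchSwinnertonDyer.Theorems.GenusExact.Lw2PhantomExclusion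

end
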